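import Literature.Geometry.Riemannian.EulerFormFour
import Literature.Geometry.Riemannian.QCurvatureFour
import HarnessLib

/-!
# The five equivalent forms of the Chern–Gauss–Bonnet formula on a closed Riemannian `4`-manifold

A summary file (topic `Geometry/Riemannian`) for whoever vends or proves the
Chern–Gauss–Bonnet theorem in dimension four — the single classical input still standing between
the tree and Chang–Gursky–Yang 2003, Thm. A (`changGurskyYang_sphere_four`, reductions in
`ChangGurskyYangEuler.lean`, `EulerFormFour.lean`, `QCurvatureFour.lean`), and equally a hypothesis
of `ChangGurskyYangPIC.lean` and `GurskyEinsteinGapProofs.lean`. For a `C^∞` Riemannian metric `g`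
on a closed `4`-manifold (compact Hausdorff, modelled on `ℝ⁴`) and ANY real number `χ`, the following are equivalent (`chernGaussBonnet_four_tfae`, with the single-integral
form of (0.4), `integral_gaussBonnetIntegrand_eq`):

1. Chern's form `∫_M Pf(Ω_g) dV_g = 4π² χ` (Chern 1944; Chern 1945, (10)–(11); `Pf = eulerForm`,
   `EulerFormFour.lean`);
2. Chang–Gursky–Yang's (1.1) `8π² χ = ¼ ∫_M |W_g|² dV_g + ∫_M σ₂(A_g) dV_g` (Chang–Gursky–Yang 2003,
   p. 111; `weylEnergy`, `sigma2WeylSchoutenIntegral`);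
3. the classical tensor-norm form `32π² χ = ∫_M (|Rm|² − 4|Ric|² + R²) dV` (Besse 1987, 4.80 with
   `|R|²_Besse = ¼|Rm|²`; `curvNormSqWith`, `normSq Ric`);
4. the `Q`-curvature form `4π² χ = ⅛ ∫_M |W|² dV + ∫_M Q dV` (Chang–Gursky–Yang 2003, (1.11)–(1.12);
   `qCurvature`, `QCurvatureFour.lean`);
5. (0.4) of Chang–Gursky–Yang 2003 (p. 107; Besse 1987, 6.31 in curvature-operator norms),
   `8π² χ = ∫_M (¼|W|² − ½|E|² + R²/24) dV` (`weylNormSq`, `tracelessRicciNormSq`, `scalarCurvature`);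

so that the theorem `χ(M) = relEuler ℤ ℤ M ∅` satisfies any one of them iff it satisfies all
(`chernGaussBonnet_four_tfae_relEuler`). The equivalences are `integral_eulerForm_eq_iff`,
`integral_eulerForm_eq_curvNormSqWith` (`EulerFormFour.lean`) and `chernGaussBonnet_iff_qCurvature`
(`QCurvatureFour.lean`); they hold on the round `S⁴` with `χ = 2` (ibid.). Everything is proved; no
definition, no named fact.

## References

* S.-Y. A. Chang, M. J. Gursky, P. C. Yang, *A conformally invariant sphere theorem in four
  dimensions*, Publ. Math. IHÉS 98 (2003) 105–143, (0.4) p. 107, (1.1) p. 111, (1.11)–(1.12)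
  pp. 113–114. [ChangGurskyYang2003]
* S.-S. Chern, Ann. of Math. 45 (1944) 747–752; Ann. of Math. 46 (1945) 674–684, (10)–(11).
  [Chern1944] [Chern1945]
* A. L. Besse, *Einstein Manifolds* (1987), 4.80 (p. 135) and 6.31 (p. 161). [Besse1987]
-/

noncomputable section

open MeasureTheory Module
open scoped Manifold ContDiff ENNReal

namespace Literature.Geometry.Riemannian

open Literature.Geometry.Lorentzian (PseudoRiemannianMetric riemannianMeasure)
open Literature.Geometry.Lorentzian.PseudoRiemannianMetric
open Literature.AlgebraicTopology.SingularHomology (relEuler)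

variable {M : Type*} [TopologicalSpace M] [ChartedSpace (EuclideanSpace ℝ (Fin 4)) M]
  [IsManifold (𝓡 4) ∞ M] [T2Space M] [CompactSpace M] [MeasurableSpace M] [BorelSpace M]
  (g : PseudoRiemannianMetric (𝓡 4) ∞ (EuclideanSpace ℝ (Fin 4)) (TangentSpace (𝓡 4) : M → Type _))
  [g.HasLeviCivita]

/-- **(0.4) as a single integral**: on a closed Riemannian `4`-manifold,
`∫ (¼|W|² − ½|E|² + R²/24) dV = ¼ ∫|W|² dV + ∫ σ₂(A) dV` (`σ₂(A) = −½|E|² + R²/24` pointwise,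
`sigma2WeylSchouten_eq`; all three functions continuous, hence integrable on the compact manifold of
finite volume). [cite: ChangGurskyYang2003, (0.4) p. 107 and (1.1) p. 111] -/
theorem integral_gaussBonnetIntegrand_eq (hg : g.IsRiemannian) :
    ∫ x, (1 / 4 * g.weylNormSq x - 1 / 2 * g.tracelessRicciNormSq x + g.scalarCurvature x ^ 2 / 24)
        ∂(riemannianMeasure (g.toContMDiffRiemannianMetric hg)) =
      1 / 4 * g.weylEnergy.toReal + g.sigma2WeylSchoutenIntegral := by
  have hE : finrank ℝ (EuclideanSpace ℝ (Fin 4)) = 4 := finrank_euclideanSpace_fin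
  obtain ⟨hW, hWE⟩ := g.weylEnergy_eq_ofReal_integral hg hE
  have hσ := g.integrable_sigma2WeylSchouten hg hE
  have hpt : ∀ x, 1 / 4 * g.weylNormSq x - 1 / 2 * g.tracelessRicciNormSq x +
      g.scalarCurvature x ^ 2 / 24 = 1 / 4 * g.weylNormSq x + g.sigma2WeylSchouten x := by
    intro x
    rw [g.sigma2WeylSchouten_eq (WithTop.coe_le_coe.mpr le_top) hE fun v hv ↦ hg x v hv]
    ring
  rw [integral_congr_ae (ae_of_all _ hpt), integral_add (hW.const_mul _) hσ, integral_const_mul,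
    hWE, ENNReal.toReal_ofReal (integral_nonneg fun x ↦ g.weylNormSq_nonneg x),
    g.sigma2WeylSchoutenIntegral_eq hg]

/-- **The five equivalent forms of the Chern–Gauss–Bonnet formula in dimension four.** For a `C^∞`
Riemannian metric on a closed `4`-manifold modelled on `ℝ⁴` and any real `χ`, the following are
equivalent: (1) `∫ Pf(Ω) dV = 4π²χ` (Chern); (2) `8π²χ = ¼∫|W|² dV + ∫σ₂(A) dV` ((1.1) of
Chang–Gursky–Yang 2003); (3) `32π²χ = ∫(|Rm|² − 4|Ric|² + R²) dV` (Besse 1987, 4.80, tensor norms);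
(4) `4π²χ = ⅛∫|W|² dV + ∫Q dV` (Chang–Gursky–Yang 2003, (1.11)–(1.12)); (5)
`8π²χ = ∫(¼|W|² − ½|E|² + R²/24) dV` ((0.4) of Chang–Gursky–Yang 2003; Besse 1987, 6.31).
[cite: ChangGurskyYang2003, (0.4) p. 107, (1.1) p. 111 and (1.11)] [cite: Besse1987, 4.80 and 6.31]
[cite: Chern1945, (10)] -/
theorem chernGaussBonnet_four_tfae (hg : g.IsRiemannian) (χ : ℝ) :
    List.TFAE [
      ∫ x, g.eulerForm x ∂(riemannianMeasure (g.toContMDiffRiemannianMetric hg)) =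
        4 * Real.pi ^ 2 * χ,
      8 * Real.pi ^ 2 * χ = 1 / 4 * g.weylEnergy.toReal + g.sigma2WeylSchoutenIntegral,
      32 * Real.pi ^ 2 * χ =
        ∫ x, (g.curvNormSqWith g.leviCivita x - 4 * g.normSq x (g.ricci x) +
          g.scalarCurvature x ^ 2) ∂(riemannianMeasure (g.toContMDiffRiemannianMetric hg)),
      4 * Real.pi ^ 2 * χ = 1 / 8 * g.weylEnergy.toReal +
        ∫ x, g.qCurvature x ∂(riemannianMeasure (g.toContMDiffRiemannianMetric hg)),
      8 * Real.pi ^ 2 * χ =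
        ∫ x, (1 / 4 * g.weylNormSq x - 1 / 2 * g.tracelessRicciNormSq x +
          g.scalarCurvature x ^ 2 / 24) ∂(riemannianMeasure (g.toContMDiffRiemannianMetric hg))] := by
  have hE : finrank ℝ (EuclideanSpace ℝ (Fin 4)) = 4 := finrank_euclideanSpace_fin
  have h12 := g.integral_eulerForm_eq_iff hg hE χ
  have h24 := g.chernGaussBonnet_iff_qCurvature hg χ
  have h13 : (∫ x, g.eulerForm x ∂(riemannianMeasure (g.toContMDiffRiemannianMetric hg)) =
        4 * Real.pi ^ 2 * χ) ↔
      32 * Real.pi ^ 2 * χ =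
        ∫ x, (g.curvNormSqWith g.leviCivita x - 4 * g.normSq x (g.ricci x) +
          g.scalarCurvature x ^ 2) ∂(riemannianMeasure (g.toContMDiffRiemannianMetric hg)) := by
    rw [(g.integral_eulerForm_eq_curvNormSqWith hg hE).2]
    constructor <;> intro h <;> linarith
  have h25 : 8 * Real.pi ^ 2 * χ = 1 / 4 * g.weylEnergy.toReal + g.sigma2WeylSchoutenIntegral ↔
      8 * Real.pi ^ 2 * χ =
        ∫ x, (1 / 4 * g.weylNormSq x - 1 / 2 * g.tracelessRicciNormSq x +
          g.scalarCurvature x ^ 2 / 24) ∂(riemannianMeasure (g.toContMDiffRiemannianMetric hg)) := by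
    rw [integral_gaussBonnetIntegrand_eq g hg]
  tfae_have 1 ↔ 2 := h12
  tfae_have 2 ↔ 4 := h24
  tfae_have 1 ↔ 3 := h13
  tfae_have 2 ↔ 5 := h25
  tfae_finish

/-- The same with `χ = χ(M) = relEuler ℤ ℤ M ∅`, the Euler characteristic of singular homology: the
Chern–Gauss–Bonnet THEOREM in any one of the five forms gives the other four.
[cite: ChangGurskyYang2003, (0.4) p. 107, (1.1) p. 111 and (1.11)] [cite: Besse1987, 4.80 and 6.31] -/
theorem chernGaussBonnet_four_tfae_relEuler (hg : g.IsRiemannian) :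
    List.TFAE [
      ∫ x, g.eulerForm x ∂(riemannianMeasure (g.toContMDiffRiemannianMetric hg)) =
        4 * Real.pi ^ 2 * (relEuler ℤ ℤ M ∅ : ℝ),
      8 * Real.pi ^ 2 * (relEuler ℤ ℤ M ∅ : ℝ) =
        1 / 4 * g.weylEnergy.toReal + g.sigma2WeylSchoutenIntegral,
      32 * Real.pi ^ 2 * (relEuler ℤ ℤ M ∅ : ℝ) =
        ∫ x, (g.curvNormSqWith g.leviCivita x - 4 * g.normSq x (g.ricci x) +
          g.scalarCurvature x ^ 2) ∂(riemannianMeasure (g.toContMDiffRiemannianMetric hg)),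
      4 * Real.pi ^ 2 * (relEuler ℤ ℤ M ∅ : ℝ) = 1 / 8 * g.weylEnergy.toReal +
        ∫ x, g.qCurvature x ∂(riemannianMeasure (g.toContMDiffRiemannianMetric hg)),
      8 * Real.pi ^ 2 * (relEuler ℤ ℤ M ∅ : ℝ) =
        ∫ x, (1 / 4 * g.weylNormSq x - 1 / 2 * g.tracelessRicciNormSq x +
          g.scalarCurvature x ^ 2 / 24) ∂(riemannianMeasure (g.toContMDiffRiemannianMetric hg))] :=
  chernGaussBonnet_four_tfae g hg _

end Literature.Geometry.Riemannian

end
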